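import Mathlib
import HarnessLib

/-!
# QUANT lane R8, front "FAR beyond trees", layer one — the BUNDLE DICHOTOMY (pendant trees flatten at layer one): algebraic core

builds on p205010 (kernel theorem, internal audit signed; external expert review pending)

Support file (`--supports stmt-CriticalPhenomena-4575`), seat `prim-quant-p1` (gen 18); memo
`run/shared/lean/prim/quant/prim-quant-p1-g18/FOR-LEAD-UNICYCLIC-TREES.md` §1–§2 (exact numerics `num/bundle.py`, `num/decomp_check.py`).
Pure real algebra on a finset of "lighter leaves"; standard axioms; no sorries; no measure theory (the graph-level reading of these
quantities as `prodBernoulli` probabilities is file F-B of the memo's kernel plan).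

**Setting (memo §1).**  In a finite weighted graph with observer `o` and relay set `A`, a PENDANT BUNDLE is a vertex `u ∉ A ∪ {o}` whose
positive-weight pairs are one parent `p` (weight `w`) and `d ≥ 2` pendant relays: the heaviest leaf `ℓ₁` (weight `p₁`) and the lighter
leaves `i ∈ I` (weights `q i ≤ p₁`).  With `R = #{i ∈ I : s(u,i) open}` (independent Bernoulli), `z0 = P(R = 0) = ∏ (1 − q i)` and
`z1 = P(R = 1) = Σ_i q i ∏_{j ≠ i} (1 − q j)`, the layer-one event decomposes as
`P(N ≥ 2) = A + B·h + C·t` with `B, C ≥ 0` determined off the bundle and `h = P(X ≥ 1)`, `t = P(X ≥ 2)`,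
`X = 𝟙[s(p,u) open]·#{open leaf pairs}`:
* current bundle: `hCur = w (p₁ + (1 − p₁)(1 − z0))`, `tCur = w (p₁ (1 − z0) + (1 − p₁)(1 − z0 − z1))`;
* DETACH (re-hang `ℓ₁` at `p` with weight `w p₁`): `hDet = 1 − (1 − w p₁)(1 − w (1 − z0))`, `tDet = w p₁ · w (1 − z0) + (1 − w p₁) · w (1 − z0 − z1)`;
* GLUE (`w ↦ w p₁`, `p₁ ↦ 1`, `q i ↦ q i / p₁`): `hGlue = w p₁`, `tGlue = w p₁ (1 − z0(q/p₁))`.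
Both moves preserve every relay marginal (leaf `i`: `w · q i`), hence the mean and the least marginal of `Quant.FarRelayRow` at `j = 1`.

* `Quant.Bundle.z0`, `Quant.Bundle.z1` and their bounds (`z0_nonneg`, `z1_nonneg`, `z0_add_z1_le_one`, …);
* `Quant.Bundle.conc_ineq` — the concavity inequality `p₁ (1 − ∏ (1 − q i / p₁)) ≤ 1 − ∏ (1 − q i)` for `0 ≤ q i ≤ p₁`, `0 < p₁ ≤ 1`;
* `Quant.Bundle.det_sub_cur`, `Quant.Bundle.glue_sub_cur_le` — the two increments of `B h + C t`:
  `ΔΦ_detach = w (1 − w) p₁ (B (1 − z0) − C z1)` (identity) and, when `C z1 ≤ B (1 − z0)`, `ΔΦ_glue ≤ C w (p₁ (1 − z0(q/p₁)) − (1 − z0)) ≤ 0`;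
* **`Quant.Bundle.dichotomy`** — for all `B, C ≥ 0`: `B hDet + C tDet ≤ B hCur + C tCur` or `B hGlue + C tGlue ≤ B hCur + C tCur`
  (test: `B (1 − z0) ≤ C z1`).  Consequence (memo §3, files F-B/F-C): at layer one every pendant tree flattens into hairs at its attachment
  vertex or the FAR(1) conclusion holds outright; FAR(1) on every unicyclic support follows from `HairyCycle.SunFAR K 1` for all `K`,
  and FAR(1) on trees from the star case.
Nearest prior art searched (corpus hybrid "two-terminal reliability pendant vertex splitting at least two terminals connected", galaxy
"vertex splitting|factoring theorem|K-terminal"): network-reliability factoring / series–parallel reductions are law IDENTITIES; the monotone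
(law-changing) detach/glue dichotomy for the event "at least two relays" was not found — [this work].
-/

noncomputable section

namespace Summit.CriticalPhenomena.PercolationContinuityZ3.Theorems

namespace Quant

namespace Bundle

open Finset

variable {ι : Type*} [DecidableEq ι]

/-! ## The law of the number of open lighter leaves -/

/-- `z0 I q = ∏_{i∈I} (1 − q i)` = P(no lighter leaf pair open). [this work] -/
def z0 (I : Finset ι) (q : ι → ℝ) : ℝ := ∏ i ∈ I, (1 - q i)

/-- `z1 I q = Σ_{i∈I} q i · ∏_{j∈I∖i} (1 − q j)` = P(exactly one lighter leaf pair open). [this work] -/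
def z1 (I : Finset ι) (q : ι → ℝ) : ℝ := ∑ i ∈ I, q i * ∏ j ∈ I.erase i, (1 - q j)

omit [DecidableEq ι] in
/-- `z0 ∅ = 1`. [this work] -/
@[simp] theorem z0_empty (q : ι → ℝ) : z0 (∅ : Finset ι) q = 1 := by simp [z0]

/-- `z1 ∅ = 0`. [this work] -/
@[simp] theorem z1_empty (q : ι → ℝ) : z1 (∅ : Finset ι) q = 0 := by simp [z1]

/-- Recursion for `z0`: `z0 (insert a I) = (1 − q a) · z0 I`. [this work] -/
theorem z0_insert {a : ι} {I : Finset ι} (ha : a ∉ I) (q : ι → ℝ) :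
    z0 (insert a I) q = (1 - q a) * z0 I q := by
  unfold z0; rw [prod_insert ha]

/-- Recursion for `z1`: `z1 (insert a I) = q a · z0 I + (1 − q a) · z1 I`. [this work] -/
theorem z1_insert {a : ι} {I : Finset ι} (ha : a ∉ I) (q : ι → ℝ) :
    z1 (insert a I) q = q a * z0 I q + (1 - q a) * z1 I q := by
  unfold z1 z0
  rw [sum_insert ha, erase_insert ha]
  congr 1
  rw [mul_sum]
  refine sum_congr rfl fun i hi => ?_
  have hai : a ≠ i := fun h => ha (h ▸ hi)
  rw [erase_insert_of_ne hai, prod_insert (fun h => ha (mem_of_mem_erase h))]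
  ring

omit [DecidableEq ι] in
/-- `0 ≤ z0` when `q i ≤ 1`. [this work] -/
theorem z0_nonneg {I : Finset ι} {q : ι → ℝ} (hq1 : ∀ i ∈ I, q i ≤ 1) : 0 ≤ z0 I q :=
  prod_nonneg fun i hi => by linarith [hq1 i hi]

omit [DecidableEq ι] in
/-- `z0 ≤ 1` when `0 ≤ q i ≤ 1`. [this work] -/
theorem z0_le_one {I : Finset ι} {q : ι → ℝ} (hq0 : ∀ i ∈ I, 0 ≤ q i) (hq1 : ∀ i ∈ I, q i ≤ 1) : z0 I q ≤ 1 :=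
  prod_le_one (fun i hi => by linarith [hq1 i hi]) fun i hi => by linarith [hq0 i hi]

/-- `0 ≤ z1` when `0 ≤ q i ≤ 1`. [this work] -/
theorem z1_nonneg {I : Finset ι} {q : ι → ℝ} (hq0 : ∀ i ∈ I, 0 ≤ q i) (hq1 : ∀ i ∈ I, q i ≤ 1) : 0 ≤ z1 I q :=
  sum_nonneg fun i hi => mul_nonneg (hq0 i hi)
    (prod_nonneg fun j hj => by linarith [hq1 j (mem_of_mem_erase hj)])

/-- `z0 + z1 ≤ 1` (a sub-probability) when `0 ≤ q i ≤ 1`. [this work] -/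
theorem z0_add_z1_le_one {I : Finset ι} {q : ι → ℝ} (hq0 : ∀ i ∈ I, 0 ≤ q i) (hq1 : ∀ i ∈ I, q i ≤ 1) :
    z0 I q + z1 I q ≤ 1 := by
  induction I using Finset.induction_on with
  | empty => simp
  | insert a I ha ih =>
    have hq0' : ∀ i ∈ I, 0 ≤ q i := fun i hi => hq0 i (mem_insert_of_mem hi)
    have hq1' : ∀ i ∈ I, q i ≤ 1 := fun i hi => hq1 i (mem_insert_of_mem hi)
    have h0 := z0_nonneg (q := q) hq1'
    have ha0 := hq0 a (mem_insert_self a I)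
    have ha1 := hq1 a (mem_insert_self a I)
    have h1 := z1_nonneg (q := q) hq0' hq1'
    rw [z0_insert ha, z1_insert ha]
    nlinarith [ih hq0' hq1']

omit [DecidableEq ι] in
/-- Monotonicity of `z0` under shrinking the weights: for `λ ≤ 1` and `0 ≤ q i ≤ 1`, `∏ (1 − q i) ≤ ∏ (1 − λ q i)`. [this work] -/
theorem z0_le_z0_smul {I : Finset ι} {q : ι → ℝ} {lam : ℝ} (hl1 : lam ≤ 1)
    (hq0 : ∀ i ∈ I, 0 ≤ q i) (hq1 : ∀ i ∈ I, q i ≤ 1) :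
    z0 I q ≤ z0 I (fun i => lam * q i) := by
  unfold z0
  refine prod_le_prod (fun i hi => by linarith [hq1 i hi]) fun i hi => ?_
  have : lam * q i ≤ q i := by nlinarith [hq0 i hi]
  linarith

/-- **The concavity inequality** in product form: for `0 ≤ λ ≤ 1` and `0 ≤ q i ≤ 1`,
`λ · (1 − ∏_{i∈I} (1 − q i)) ≤ 1 − ∏_{i∈I} (1 − λ q i)` (the map `λ ↦ 1 − ∏ (1 − λ q i)` is concave and vanishes at `0`). [this work] -/
theorem conc_ineq_smul {I : Finset ι} {q : ι → ℝ} {lam : ℝ} (hl0 : 0 ≤ lam) (hl1 : lam ≤ 1)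
    (hq0 : ∀ i ∈ I, 0 ≤ q i) (hq1 : ∀ i ∈ I, q i ≤ 1) :
    lam * (1 - z0 I q) ≤ 1 - z0 I (fun i => lam * q i) := by
  induction I using Finset.induction_on with
  | empty => simp
  | insert a I ha ih =>
    have hq0' : ∀ i ∈ I, 0 ≤ q i := fun i hi => hq0 i (mem_insert_of_mem hi)
    have hq1' : ∀ i ∈ I, q i ≤ 1 := fun i hi => hq1 i (mem_insert_of_mem hi)
    have ih' := ih hq0' hq1'
    have ha0 := hq0 a (mem_insert_self a I)
    have ha1 := hq1 a (mem_insert_self a I)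
    -- `P := z0 I (λq) ≥ P₁ := z0 I q ≥ 0`
    have hP1 : 0 ≤ z0 I q := z0_nonneg hq1'
    have hPP : z0 I q ≤ z0 I (fun i => lam * q i) := z0_le_z0_smul hl1 hq0' hq1'
    rw [z0_insert ha, z0_insert ha]
    -- goal: lam * (1 - (1 - q a) * P₁) ≤ 1 - (1 - lam * q a) * P
    -- from ih': lam * (1 - P₁) ≤ 1 - P, and lam * q a * P₁ ≤ lam * q a * P
    have h2 : lam * q a * z0 I q ≤ lam * q a * z0 I (fun i => lam * q i) :=
      mul_le_mul_of_nonneg_left hPP (mul_nonneg hl0 ha0)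
    nlinarith [ih', h2]

/-- **The concavity inequality** of memo §2 (ii): for `0 < p₁ ≤ 1` and `0 ≤ q i ≤ p₁`,
`p₁ · (1 − ∏ (1 − q i / p₁)) ≤ 1 − ∏ (1 − q i)`. [this work] -/
theorem conc_ineq {I : Finset ι} {q : ι → ℝ} {p₁ : ℝ} (hp0 : 0 < p₁) (hp1 : p₁ ≤ 1)
    (hq0 : ∀ i ∈ I, 0 ≤ q i) (hqp : ∀ i ∈ I, q i ≤ p₁) :
    p₁ * (1 - z0 I (fun i => q i / p₁)) ≤ 1 - z0 I q := by
  have key := conc_ineq_smul (I := I) (q := fun i => q i / p₁) (lam := p₁) hp0.le hp1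
    (fun i hi => div_nonneg (hq0 i hi) hp0.le) (fun i hi => (div_le_one hp0).2 (hqp i hi))
  have hfun : (fun i => p₁ * (q i / p₁)) = q := by
    funext i; field_simp
  rw [hfun] at key
  exact key

/-! ## The six closed forms -/

section Forms

variable (w p₁ : ℝ) (I : Finset ι) (q : ι → ℝ)

/-- Current bundle: `h = P(X ≥ 1) = w (p₁ + (1 − p₁)(1 − z0))`. [this work] -/
def hCur : ℝ := w * (p₁ + (1 - p₁) * (1 - z0 I q))

/-- Current bundle: `t = P(X ≥ 2) = w (p₁ (1 − z0) + (1 − p₁)(1 − z0 − z1))`. [this work] -/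
def tCur : ℝ := w * (p₁ * (1 - z0 I q) + (1 - p₁) * (1 - z0 I q - z1 I q))

/-- After DETACH (heaviest leaf re-hung at the parent with weight `w p₁`, independent of the bundle):
`h' = 1 − (1 − w p₁)(1 − w (1 − z0))`. [this work] -/
def hDet : ℝ := 1 - (1 - w * p₁) * (1 - w * (1 - z0 I q))

/-- After DETACH: `t' = w p₁ · w (1 − z0) + (1 − w p₁) · w (1 − z0 − z1)`. [this work] -/
def tDet : ℝ := w * p₁ * (w * (1 - z0 I q)) + (1 - w * p₁) * (w * (1 - z0 I q - z1 I q))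

/-- After GLUE (`w ↦ w p₁`, heaviest leaf sure, `q i ↦ q i / p₁`): `h'' = w p₁`. [this work] -/
def hGlue : ℝ := w * p₁

/-- After GLUE: `t'' = w p₁ · (1 − z0 (q / p₁))`. [this work] -/
def tGlue : ℝ := w * p₁ * (1 - z0 I (fun i => q i / p₁))

end Forms

/-! ## The two increments and the dichotomy -/

/-- DETACH increment (identity): `(B hDet + C tDet) − (B hCur + C tCur) = w (1 − w) p₁ (B (1 − z0) − C z1)`. [this work] -/
theorem det_sub_cur (B C w p₁ : ℝ) (I : Finset ι) (q : ι → ℝ) :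
    (B * hDet w p₁ I q + C * tDet w p₁ I q) - (B * hCur w p₁ I q + C * tCur w p₁ I q) =
      w * (1 - w) * p₁ * (B * (1 - z0 I q) - C * z1 I q) := by
  unfold hDet tDet hCur tCur; ring

/-- GLUE increment (identity): `(B hGlue + C tGlue) − (B hCur + C tCur)
  = −B w (1 − p₁)(1 − z0) + C w (p₁ (1 − z0(q/p₁)) − p₁ (1 − z0) − (1 − p₁)(1 − z0 − z1))`. [this work] -/
theorem glue_sub_cur (B C w p₁ : ℝ) (I : Finset ι) (q : ι → ℝ) :
    (B * hGlue w p₁ + C * tGlue w p₁ I q) - (B * hCur w p₁ I q + C * tCur w p₁ I q) =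
      -(B * (w * ((1 - p₁) * (1 - z0 I q)))) +
        C * (w * (p₁ * (1 - z0 I (fun i => q i / p₁)) - p₁ * (1 - z0 I q) - (1 - p₁) * (1 - z0 I q - z1 I q))) := by
  unfold hGlue tGlue hCur tCur; ring

/-- GLUE branch: if `C z1 ≤ B (1 − z0)` (the DETACH test fails) then
`(B hGlue + C tGlue) − (B hCur + C tCur) ≤ C w (p₁ (1 − z0(q/p₁)) − (1 − z0)) ≤ 0`. [this work] -/
theorem glue_sub_cur_le {B C w p₁ : ℝ} {I : Finset ι} {q : ι → ℝ} (hC : 0 ≤ C) (hw0 : 0 ≤ w)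
    (hp0 : 0 < p₁) (hp1 : p₁ ≤ 1) (hq0 : ∀ i ∈ I, 0 ≤ q i) (hqp : ∀ i ∈ I, q i ≤ p₁)
    (htest : C * z1 I q ≤ B * (1 - z0 I q)) :
    (B * hGlue w p₁ + C * tGlue w p₁ I q) - (B * hCur w p₁ I q + C * tCur w p₁ I q) ≤ 0 := by
  rw [glue_sub_cur]
  have hconc := conc_ineq (I := I) hp0 hp1 hq0 hqp
  -- replace `B (1 − z0)` by the smaller `C z1` in the negative term
  have h1 : -(B * (w * ((1 - p₁) * (1 - z0 I q)))) ≤ -(C * z1 I q * (w * (1 - p₁))) := by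
    have hfac : 0 ≤ w * (1 - p₁) := mul_nonneg hw0 (by linarith)
    nlinarith [mul_le_mul_of_nonneg_right htest hfac]
  have h2 : -(C * z1 I q * (w * (1 - p₁))) +
      C * (w * (p₁ * (1 - z0 I (fun i => q i / p₁)) - p₁ * (1 - z0 I q) - (1 - p₁) * (1 - z0 I q - z1 I q))) =
      C * w * (p₁ * (1 - z0 I (fun i => q i / p₁)) - (1 - z0 I q)) := by ring
  have h3 : C * w * (p₁ * (1 - z0 I (fun i => q i / p₁)) - (1 - z0 I q)) ≤ 0 :=
    mul_nonpos_of_nonneg_of_nonpos (mul_nonneg hC hw0) (by linarith)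
  linarith

/-- DETACH branch: if `B (1 − z0) ≤ C z1` then `B hDet + C tDet ≤ B hCur + C tCur`. [this work] -/
theorem det_le_cur {B C w p₁ : ℝ} {I : Finset ι} {q : ι → ℝ} (hw0 : 0 ≤ w) (hw1 : w ≤ 1) (hp0 : 0 ≤ p₁)
    (htest : B * (1 - z0 I q) ≤ C * z1 I q) :
    B * hDet w p₁ I q + C * tDet w p₁ I q ≤ B * hCur w p₁ I q + C * tCur w p₁ I q := by
  have hid := det_sub_cur B C w p₁ I q
  have hfac : 0 ≤ w * (1 - w) * p₁ := mul_nonneg (mul_nonneg hw0 (by linarith)) hp0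
  have : w * (1 - w) * p₁ * (B * (1 - z0 I q) - C * z1 I q) ≤ 0 :=
    mul_nonpos_of_nonneg_of_nonpos hfac (by linarith)
  linarith

/-- **BUNDLE DICHOTOMY** (memo Lemma 1).  For `B, C ≥ 0`, `0 ≤ w ≤ 1`, `0 < p₁ ≤ 1` and lighter leaves `0 ≤ q i ≤ p₁`:
detaching the heaviest leaf or gluing it does not increase `B h + C t` — i.e. at layer one one of the two marginal-preserving
moves does not increase `P(N ≥ 2) = A + B·P(X ≥ 1) + C·P(X ≥ 2)`. [this work] -/
theorem dichotomy {B C w p₁ : ℝ} {I : Finset ι} {q : ι → ℝ} (hB : 0 ≤ B) (hC : 0 ≤ C) (hw0 : 0 ≤ w) (hw1 : w ≤ 1)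
    (hp0 : 0 < p₁) (hp1 : p₁ ≤ 1) (hq0 : ∀ i ∈ I, 0 ≤ q i) (hqp : ∀ i ∈ I, q i ≤ p₁) :
    B * hDet w p₁ I q + C * tDet w p₁ I q ≤ B * hCur w p₁ I q + C * tCur w p₁ I q ∨
      B * hGlue w p₁ + C * tGlue w p₁ I q ≤ B * hCur w p₁ I q + C * tCur w p₁ I q := by
  have _ := hB
  by_cases htest : B * (1 - z0 I q) ≤ C * z1 I q
  · exact Or.inl (det_le_cur hw0 hw1 hp0.le htest)
  · right
    have := glue_sub_cur_le (B := B) hC hw0 hp0 hp1 hq0 hqp (le_of_lt (not_le.1 htest))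
    linarith

/-! ## Sanity: marginals are preserved (leaf `i` keeps marginal `w · q i`, the heaviest leaf keeps `w · p₁`) -/

/-- DETACH keeps the heaviest leaf's marginal: the new pair at the parent has weight `w p₁ = w · p₁`; GLUE keeps it:
`(w p₁) · 1 = w p₁`; and GLUE keeps every lighter marginal: `(w p₁) · (q i / p₁) = w · q i`. [this work] -/
theorem marg_glue (w p₁ : ℝ) (hp0 : p₁ ≠ 0) (qi : ℝ) : w * p₁ * (qi / p₁) = w * qi := by
  field_simp

end Bundle

end Quant

end Summit.CriticalPhenomena.PercolationContinuityZ3.Theorems
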